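import Literature.Geometry.Lorentzian.DataHypersurfaceLocalAcausal
import Literature.Geometry.Lorentzian.HypersurfaceCorrespondingBoundary
import HarnessLib

/-!
# Local trichotomy at a data hypersurface: near a point of the hypersurface every point lies on
# it, above it or below it (Gaussian normal coordinates; O'Neill 1983, Ch. 14, Lemma 14.42 ff.)

Let `𝒮 = (M, g, τ, ι, ν)` be a data embedding (`Literature.Geometry.Lorentzian.DataEmbedding`:
`ι : X → M` embeds the data manifold as a spacelike hypersurface with future unit normal `ν`).

* `DataEmbedding.exists_nhds_subset_trichotomy` — **for every `x₀ ∈ X` and every open `O ∋ x₀`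
  there is an open `B ∋ ι x₀` with `B ⊆ ι(O) ∪ I⁺(ι O) ∪ I⁻(ι O)`**: in Gaussian normal
  coordinates `E(x, t) = exp_{ι x}(t ν x)` about `ι x₀` — a local diffeomorphism at `(x₀, 0)`
  (`isLocalDiffeomorphAt_normalExp_zero`, `Literature/Geometry/Riemannian/NormalExponentialMap.lean`)
  — the point `E(x, t)` is `ι x` for `t = 0` and lies on the future (past) timelike normal geodesic
  from `ι x` for `t > 0` (`t < 0`), hence in `I±(ι x)` (`expMap_mem_chronologicalFuture`).

Consequences for a set `S` with this LOCAL TRICHOTOMY property which is ACAUSAL in a causal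
spacetime (pure causality, for any `S ⊆ M`; with the localised form over a map `ι`):

* `LorentzianMetric.causalFuture_subset_of_localTrichotomy` — **`J⁺(S) ⊆ S ∪ I⁺(S)`** (and the
  time dual `causalPast_subset_of_localTrichotomy`): a causal curve from `w ∈ S` to `x ∉ S` is off
  `S` after `w` (acausality), so shortly after `w` it is in `I⁺(S)` — whence `x ∈ I⁺(S)` by
  push-up — or in `I⁻(S)`, which would make `w ≪ s'` for some `s' ∈ S`. This is the horismos
  hypothesis `hJS` of the horizon lemma of `HypersurfaceCorrespondingBoundary`, here WITHOUT a
  Cauchy neighbourhood of `S` (compare `causalFuture_subset_union_chronologicalFuture_of_cauchy_nhds`);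
  O'Neill 1983, Ch. 14, Lemma 14.42;
* `LorentzianMetric.mem_closure_preimage_chronologicalPast` — **a point `ι u < x` causally below
  `x` is a limit of points of the hypersurface chronologically below `x`**:
  `u ∈ closure (ι⁻¹ I⁻(x))` (push-up along the hypersurface: the same argument with a small `O`),
  and its time dual. Hence the chronological shadow `I⁻(x) ∩ ι(X)` and the causal shadow
  `J⁻(x) ∩ ι(X)` of a point `x ∉ ι(X)` have the same closure in `X`
  (`preimage_causalPast_subset_of_preimage_chronologicalPast_subset`).

Everything is proved; no definitions and no named facts (D-0026). Consumer: the shadow form of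
the domain of dependence of an acausal data hypersurface (`HypersurfaceShadowDomain`), for the
hypersurface sub-data maximality statement of summit `FinalStateConjecture`.

## References

* B. O'Neill, *Semi-Riemannian geometry with applications to relativity*, Academic Press 1983,
  Ch. 14, Cor. 14.1, Lemma 14.42 (pp. 402, 425); Ch. 5, Prop. 5.34. [ONeillSemiRiemannian1983]
* S. W. Hawking, G. F. R. Ellis, *The large scale structure of space-time*, CUP 1973, §6.5.
  [HawkingEllis1973CUP]
* J. M. Lee, *Introduction to Riemannian Manifolds*, 2nd ed. (2018), Thm. 5.25.
  [LeeRiemannianManifolds2018]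
-/

noncomputable section

open Bundle Set Filter Function TopologicalSpace Topology
open scoped Manifold ContDiff Topology

namespace Literature.Geometry.Lorentzian

open Literature.Geometry.Riemannian

universe u

/-! ### The trichotomy near a point of a data hypersurface -/

section Data

variable {n : ℕ} {X : Type u} [TopologicalSpace X] [ChartedSpace (EuclideanSpace ℝ (Fin n)) X]
  [IsManifold (𝓡 n) ∞ X] [ConnectedSpace X] {D : InitialDataSet (𝓡 n) X}

namespace DataEmbedding

/-- **Local trichotomy at a data hypersurface.** For a data embedding `𝒮 = (M, g, τ, ι, ν)`,
`x₀ ∈ X` and an open `O ∋ x₀`, some open neighbourhood `B` of `ι x₀` satisfies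
`B ⊆ ι(O) ∪ I⁺(ι O) ∪ I⁻(ι O)`: `B` is the image of a neighbourhood of `(x₀, 0)` in `O × ℝ`
under the Gaussian normal coordinates `E(x, t) = exp_{ι x}(t ν x)` (a local diffeomorphism at
`(x₀, 0)`), and `E(x, t) ∈ I⁺(ι x)` for `t > 0`, `∈ I⁻(ι x)` for `t < 0`, `= ι x` for `t = 0`
(the normal geodesics are timelike). [cite: ONeillSemiRiemannian1983, Ch. 14, Lemma 14.42 ff.; Ch. 5, Prop. 5.34] -/
theorem exists_nhds_subset_trichotomy (𝒮 : DataEmbedding D) (x₀ : X) {O : Set X}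
    (hO : IsOpen O) (hx₀ : x₀ ∈ O) :
    ∃ B : Set 𝒮.carrier, IsOpen B ∧ 𝒮.embed x₀ ∈ B ∧
      B ⊆ 𝒮.embed '' O ∪ 𝒮.metric.chronologicalFuture 𝒮.timeOrientation (𝒮.embed '' O) ∪
        𝒮.metric.chronologicalPast 𝒮.timeOrientation (𝒮.embed '' O) := by
  classical
  haveI : 𝒮.metric.HasLeviCivita := 𝒮.metric.toPseudoRiemannianMetric.hasLeviCivita
  haveI h1 : CovariantDerivative.ContMDiffCovariantDerivative 𝒮.metric.leviCivita 1 :=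
    ⟨𝒮.metric.isLocallyContMDiff_leviCivita_holds 1 (by exact_mod_cast le_top) univ isOpen_univ⟩
  haveI hinf : CovariantDerivative.ContMDiffCovariantDerivative 𝒮.metric.leviCivita ∞ :=
    contMDiffCovariantDerivative_leviCivita_infty 𝒮.metric.toPseudoRiemannianMetric le_rfl
  haveI : Fact ((1 : ℕ∞ω) ≤ ∞) := ⟨by exact_mod_cast le_top⟩
  set cov := 𝒮.metric.leviCivita with hcov
  -- Gaussian normal coordinates: `E(x, t) = exp_{ι x}(t ν x)` is a local diffeomorphism at `(x₀, 0)`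
  have hνs : ContMDiff (𝓡 n) (𝓡 (n + 1)).tangent ∞
      (fun x ↦ (TotalSpace.mk' (EuclideanSpace ℝ (Fin (n + 1))) (𝒮.embed x) (𝒮.normal x) :
        TangentBundle (𝓡 (n + 1)) 𝒮.carrier)) := fun x ↦ 𝒮.contMDiffAt_embed_normal x
  have hιinj : Injective (mfderiv (𝓡 n) (𝓡 (n + 1)) 𝒮.embed x₀) := 𝒮.mfderiv_embed_injective x₀
  have hνz : 𝒮.normal x₀ ∉ range (mfderiv (𝓡 n) (𝓡 (n + 1)) 𝒮.embed x₀) :=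
    not_mem_range_of_normal (F := EuclideanSpace ℝ (Fin (n + 1))) (F' := EuclideanSpace ℝ (Fin n))
      (A := mfderiv (𝓡 n) (𝓡 (n + 1)) 𝒮.embed x₀) (𝒮.metric.val (𝒮.embed x₀))
      (ne_of_eq_of_ne (𝒮.isFutureUnitNormal.1.2 x₀) (by norm_num))
      (fun w ↦ 𝒮.isFutureUnitNormal.1.1 x₀ w)
  have hdim : Module.finrank ℝ (EuclideanSpace ℝ (Fin n)) + 1 =
      Module.finrank ℝ (EuclideanSpace ℝ (Fin (n + 1))) := by simp
  obtain ⟨Φ, hΦ0, hΦeq⟩ := isLocalDiffeomorphAt_normalExp_zero (cov := cov) (k := (⊤ : ℕ∞))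
    (I := 𝓡 (n + 1)) (I' := 𝓡 n) le_top hνs hιinj hνz hdim
  -- the domain of the normal exponential map
  set Dom : Set (X × ℝ) :=
    {q | q.2 ∈ maximalGeodesicDomain cov (𝒮.embed q.1) (𝒮.normal q.1)} with hDom
  have hDomo : IsOpen Dom := isOpen_normalExpDomain (cov := cov) (k := (⊤ : ℕ∞)) le_top hνs
  set A : Set (X × ℝ) := (Φ.source ∩ Dom) ∩ Prod.fst ⁻¹' O with hA
  have hAo : IsOpen A := (Φ.open_source.inter hDomo).inter (hO.preimage continuous_fst)
  have hA0 : (x₀, (0 : ℝ)) ∈ A :=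
    ⟨⟨hΦ0, mem_normalExpDomain_zero (cov := cov) (ι := 𝒮.embed) (ν := 𝒮.normal) x₀⟩, hx₀⟩
  have hν : ∀ x, 𝒮.metric.IsTimelike (𝒮.normal x) := fun x ↦ by
    show 𝒮.metric.val _ (𝒮.normal x) (𝒮.normal x) < 0
    rw [𝒮.isFutureUnitNormal.1.2 x]
    norm_num
  refine ⟨Φ '' A, Φ.toOpenPartialHomeomorph.isOpen_image_of_subset_source hAo
    (fun q hq ↦ hq.1.1), ⟨(x₀, 0), hA0, ?_⟩, ?_⟩
  · rw [← hΦeq hΦ0]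
    exact normalExp_zero (cov := cov) (ι := 𝒮.embed) (ν := 𝒮.normal) x₀
  · rintro _ ⟨q, ⟨⟨hqs, hqD⟩, hqO⟩, rfl⟩
    rw [← hΦeq hqs]
    have hmem : q.2 • 𝒮.normal q.1 ∈ expDomain cov (𝒮.embed q.1) :=
      (mem_maximalGeodesicDomain_iff_smul_mem_expDomain _ _ _).1 hqD
    have hqS : 𝒮.embed q.1 ∈ 𝒮.embed '' O := ⟨q.1, hqO, rfl⟩
    rcases lt_trichotomy q.2 0 with hlt | heq | hgt
    · -- `t < 0`: below the hypersurface
      right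
      have hvt : 𝒮.metric.IsTimelike (q.2 • 𝒮.normal q.1) := (hν q.1).smul hlt.ne
      have hvf : 𝒮.timeOrientation.reverse.IsFutureDirected (q.2 • 𝒮.normal q.1) := by
        rw [TimeOrientation.isFutureDirected_reverse_iff,
          ← TimeOrientation.isFutureDirected_neg_iff, ← neg_smul]
        exact (𝒮.isFutureUnitNormal.2 q.1).smul (neg_pos.2 hlt)
      exact LorentzianMetric.chronologicalFuture_mono (singleton_subset_iff.2 hqS)
        (expMap_mem_chronologicalFuture 𝒮.timeOrientation.reverse hmem hvt hvf)
    · -- `t = 0`: on the hypersurface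
      left; left
      refine ⟨q.1, hqO, ?_⟩
      show 𝒮.embed q.1 = expMap cov (𝒮.embed q.1) (q.2 • 𝒮.normal q.1)
      rw [heq]
      exact (normalExp_zero (cov := cov) (ι := 𝒮.embed) (ν := 𝒮.normal) q.1).symm
    · -- `t > 0`: above the hypersurface
      left; right
      have hvt : 𝒮.metric.IsTimelike (q.2 • 𝒮.normal q.1) := (hν q.1).smul hgt.ne'
      have hvf : 𝒮.timeOrientation.IsFutureDirected (q.2 • 𝒮.normal q.1) :=
        (𝒮.isFutureUnitNormal.2 q.1).smul hgt
      exact LorentzianMetric.chronologicalFuture_mono (singleton_subset_iff.2 hqS)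
        (expMap_mem_chronologicalFuture 𝒮.timeOrientation hmem hvt hvf)

/-- The global form: a neighbourhood of `ι x₀` inside `ι(X) ∪ I⁺(ι X) ∪ I⁻(ι X)`.
[cite: ONeillSemiRiemannian1983, Ch. 14, Lemma 14.42 ff.] -/
theorem exists_nhds_subset_trichotomy_range (𝒮 : DataEmbedding D) (x₀ : X) :
    ∃ B : Set 𝒮.carrier, IsOpen B ∧ 𝒮.embed x₀ ∈ B ∧
      B ⊆ range 𝒮.embed ∪ 𝒮.metric.chronologicalFuture 𝒮.timeOrientation (range 𝒮.embed) ∪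
        𝒮.metric.chronologicalPast 𝒮.timeOrientation (range 𝒮.embed) := by
  simpa only [image_univ] using 𝒮.exists_nhds_subset_trichotomy x₀ isOpen_univ (mem_univ x₀)

end DataEmbedding

end Data

/-! ### Consequences for an acausal set with the local trichotomy property -/

namespace LorentzianMetric

variable {E : Type*} [NormedAddCommGroup E] [NormedSpace ℝ E] {H : Type*} [TopologicalSpace H]
  {I : ModelWithCorners ℝ E H} {n : ℕ∞ω} {M : Type*} [TopologicalSpace M] [ChartedSpace H M]
  [IsManifold I ∞ M] [BoundarylessManifold I M] [FiniteDimensional ℝ E]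
  {g : LorentzianMetric I n M} {τ : TimeOrientation g}

/-- **A causal curve starting on an acausal set `S` with the local trichotomy property enters
`I⁺` of the local piece.** If `η : [a, b] → M`, `a < b`, is future causal with `η a = ι u`,
`O ∋ u` is open and `B ∋ ι u` is open with `B ⊆ ι(O) ∪ I⁺(ι O) ∪ I⁻(ι O)`, the causality
condition holds and `ι(X) ⊇ ι(O)` is acausal, then `η t₁ ∈ I⁺(ι O)` for some `t₁ ∈ (a, b]`:
`η t₁ ∈ B` for `t₁` near `a`, `η t₁ ∉ ι(X)` (a return to `ι(X)` closes a causal loop), and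
`η t₁ ∈ I⁻(ι O)` would give `ι u ≤ η t₁ ≪ ι u'`, two chronologically related points of `ι(X)`.
[cite: ONeillSemiRiemannian1983, Ch. 14, Lemma 14.42 (p. 425)] -/
theorem exists_mem_chronologicalFuture_image_of_curve (hn : 2 ≤ n)
    (hcwb : g.IsCausallyWellBehaved τ) {X' : Type*} {ι : X' → M}
    (hac : ∀ p ∈ range ι, ∀ q ∈ range ι, q ∈ g.causalFuture τ {p} → q = p)
    {u : X'} {O : Set X'} {B : Set M} (hB : IsOpen B) (huB : ι u ∈ B)
    (hBO : B ⊆ ι '' O ∪ g.chronologicalFuture τ (ι '' O) ∪ g.chronologicalPast τ (ι '' O))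
    {η : ℝ → M} {a b : ℝ} (hab : a < b) (hη : g.IsFutureCausalCurveOn τ η (Icc a b))
    (hηa : η a = ι u) :
    ∃ t₁ ∈ Ioc a b, η t₁ ∈ g.chronologicalFuture τ (ι '' O) ∧
      η t₁ ∈ g.causalFuture τ {ι u} := by
  have hn1 : (1 : ℕ∞ω) ≤ n := le_trans one_le_two hn
  -- a parameter `t₁ ∈ (a, b]` with `η t₁ ∈ B`
  have hcont : ContinuousAt η a := (hη a (left_mem_Icc.2 hab.le)).1.continuousAt
  obtain ⟨ε, hε, hball⟩ := Metric.mem_nhds_iff.1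
    (hcont.preimage_mem_nhds (hB.mem_nhds (by rw [hηa]; exact huB)))
  set t₁ := min (a + ε / 2) b with ht₁
  have hat₁ : a < t₁ := lt_min (by linarith) hab
  have ht₁b : t₁ ≤ b := min_le_right _ _
  have ht₁B : η t₁ ∈ B := hball (by
    rw [Metric.mem_ball, Real.dist_eq, abs_lt]
    constructor <;> linarith [min_le_left (a + ε / 2) b])
  -- `ι u ≤ η t₁`
  have hwt₁ : η t₁ ∈ g.causalFuture τ {ι u} :=
    Or.inr ⟨ι u, rfl, η, a, t₁, hat₁, hη.mono (Icc_subset_Icc le_rfl ht₁b), hηa, rfl⟩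
  refine ⟨t₁, ⟨hat₁, ht₁b⟩, ?_, hwt₁⟩
  -- `η t₁ ∉ ι(X)` (acausality + causality condition)
  have ht₁S : η t₁ ∉ range ι := by
    intro hS
    have heq : η t₁ = ι u := hac (ι u) ⟨u, rfl⟩ _ hS hwt₁
    exact hcwb η a t₁ hat₁ (hη.mono (Icc_subset_Icc le_rfl ht₁b)) (by rw [hηa, heq])
  rcases hBO ht₁B with (hS | hfut) | hpast
  · exact absurd (image_subset_range ι O hS) ht₁S
  · exact hfut
  · -- `η t₁ ∈ I⁻(ι O)`: some `u' ∈ O` with `ι u ≤ η t₁ ≪ ι u'`, against acausality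
    exfalso
    rw [chronologicalPast, chronologicalFuture_eq_biUnion] at hpast
    simp only [mem_iUnion, exists_prop] at hpast
    obtain ⟨z, hz, hzt⟩ := hpast
    have h1 : z ∈ g.chronologicalFuture τ {η t₁} :=
      mem_chronologicalFuture_of_mem_chronologicalPast hzt
    have h2 : z ∈ g.chronologicalFuture τ {ι u} :=
      mem_chronologicalFuture_of_mem_causalFuture hn1 hwt₁ h1
    have heq : z = ι u := hac (ι u) ⟨u, rfl⟩ z (image_subset_range ι O hz)
      (chronologicalFuture_subset_causalFuture g τ _ h2)
    obtain ⟨w', hw', γ, c, d, hcd, hγ, hγc, hγd⟩ := h2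
    rw [mem_singleton_iff] at hw'
    exact hcwb.isChronological γ c d hcd hγ (by rw [hγc, hγd, hw', heq])

/-- **`J⁺(ι X) ⊆ ι(X) ∪ I⁺(ι X)` for an acausal set with the local trichotomy property** in a
causal spacetime (O'Neill 1983, Lemma 14.42 for a spacelike hypersurface; here the spacelike
character enters only through the local trichotomy). [cite: ONeillSemiRiemannian1983, Ch. 14, Lemma 14.42 (p. 425)] -/
theorem causalFuture_subset_of_localTrichotomy (hn : 2 ≤ n)
    (hcwb : g.IsCausallyWellBehaved τ) {X' : Type*} {ι : X' → M}
    (hac : ∀ p ∈ range ι, ∀ q ∈ range ι, q ∈ g.causalFuture τ {p} → q = p)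
    (hLT : ∀ u : X', ∃ B : Set M, IsOpen B ∧ ι u ∈ B ∧
      B ⊆ range ι ∪ g.chronologicalFuture τ (range ι) ∪ g.chronologicalPast τ (range ι)) :
    g.causalFuture τ (range ι) ⊆ range ι ∪ g.chronologicalFuture τ (range ι) := by
  have hn1 : (1 : ℕ∞ω) ≤ n := le_trans one_le_two hn
  intro x hx
  by_cases hxS : x ∈ range ι
  · exact Or.inl hxS
  right
  rcases hx with hx | ⟨w, ⟨u, rfl⟩, η, a, b, hab, hη, hηa, hηb⟩
  · exact absurd hx hxS
  obtain ⟨B, hB, huB, hBO⟩ := hLT u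
  rw [← image_univ] at hBO
  obtain ⟨t₁, ht₁, hfut, -⟩ :=
    exists_mem_chronologicalFuture_image_of_curve hn hcwb hac hB huB hBO hab hη hηa
  rw [image_univ] at hfut
  have ht₁x : x ∈ g.causalFuture τ {η t₁} := by
    rcases eq_or_lt_of_le ht₁.2 with heq | hlt
    · rw [← hηb, ← heq]; exact subset_causalFuture g τ _ rfl
    · exact Or.inr ⟨η t₁, rfl, η, t₁, b, hlt, hη.mono (Icc_subset_Icc ht₁.1.le le_rfl), rfl, hηb⟩
  exact mem_chronologicalFuture_of_mem_chronologicalFuture_of_mem_causalFuture_set hn1 hfut ht₁x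

/-- Time dual: **`J⁻(ι X) ⊆ ι(X) ∪ I⁻(ι X)`** under the same (self-dual) hypotheses.
[cite: ONeillSemiRiemannian1983, Ch. 14, Lemma 14.42 (p. 425)] -/
theorem causalPast_subset_of_localTrichotomy (hn : 2 ≤ n)
    (hcwb : g.IsCausallyWellBehaved τ) {X' : Type*} {ι : X' → M}
    (hac : ∀ p ∈ range ι, ∀ q ∈ range ι, q ∈ g.causalFuture τ {p} → q = p)
    (hLT : ∀ u : X', ∃ B : Set M, IsOpen B ∧ ι u ∈ B ∧
      B ⊆ range ι ∪ g.chronologicalFuture τ (range ι) ∪ g.chronologicalPast τ (range ι)) :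
    g.causalPast τ (range ι) ⊆ range ι ∪ g.chronologicalPast τ (range ι) := by
  have hac' : ∀ p ∈ range ι, ∀ q ∈ range ι, q ∈ g.causalFuture τ.reverse {p} → q = p :=
    fun p hp q hq h ↦ (hac q hq p hp (mem_causalPast_singleton_iff.1 h)).symm
  have hLT' : ∀ u : X', ∃ B : Set M, IsOpen B ∧ ι u ∈ B ∧
      B ⊆ range ι ∪ g.chronologicalFuture τ.reverse (range ι) ∪
        g.chronologicalPast τ.reverse (range ι) := by
    intro u
    obtain ⟨B, hB, huB, hBO⟩ := hLT u
    refine ⟨B, hB, huB, fun y hy ↦ ?_⟩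
    rw [chronologicalPast_reverse]
    rcases hBO hy with (h | h) | h
    · exact Or.inl (Or.inl h)
    · exact Or.inr h
    · exact Or.inl (Or.inr h)
  exact causalFuture_subset_of_localTrichotomy (τ := τ.reverse) hn hcwb.reverse hac' hLT'

/-- **Push-up along the hypersurface: a point of `ι(X)` causally below `x` is a limit of points
of `ι(X)` chronologically below `x`.** If `ι` has the LOCALISED trichotomy property (every
`ι u` has, for every open `O ∋ u`, a neighbourhood inside `ι(O) ∪ I⁺(ι O) ∪ I⁻(ι O)`), `ι(X)` is
acausal, the causality condition holds and `x ∈ J⁺(ι u)`, `x ≠ ι u`, then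
`u ∈ closure (ι⁻¹ I⁻(x))`: the causal curve from `ι u` to `x` enters `I⁺(ι O)` at once
(`exists_mem_chronologicalFuture_image_of_curve`), so some `ι u'`, `u' ∈ O`, is chronologically
below `x`. [cite: ONeillSemiRiemannian1983, Ch. 14, Cor. 14.1 and Lemma 14.42] -/
theorem mem_closure_preimage_chronologicalPast (hn : 2 ≤ n)
    (hcwb : g.IsCausallyWellBehaved τ) {X' : Type*} [TopologicalSpace X'] {ι : X' → M}
    (hac : ∀ p ∈ range ι, ∀ q ∈ range ι, q ∈ g.causalFuture τ {p} → q = p)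
    (hLT : ∀ (u : X') (O : Set X'), IsOpen O → u ∈ O → ∃ B : Set M, IsOpen B ∧ ι u ∈ B ∧
      B ⊆ ι '' O ∪ g.chronologicalFuture τ (ι '' O) ∪ g.chronologicalPast τ (ι '' O))
    {x : M} {u : X'} (hux : x ∈ g.causalFuture τ {ι u}) (hne : x ≠ ι u) :
    u ∈ closure (ι ⁻¹' g.chronologicalPast τ {x}) := by
  have hn1 : (1 : ℕ∞ω) ≤ n := le_trans one_le_two hn
  rw [mem_closure_iff]
  intro O hO huO
  obtain ⟨B, hB, huB, hBO⟩ := hLT u O hO huO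
  rcases hux with hx | ⟨w, hw, η, a, b, hab, hη, hηa, hηb⟩
  · exact absurd hx hne
  rw [mem_singleton_iff] at hw
  rw [hw] at hηa
  obtain ⟨t₁, ht₁, hfut, -⟩ :=
    exists_mem_chronologicalFuture_image_of_curve hn hcwb hac hB huB hBO hab hη hηa
  -- `ι u' ≪ η t₁ ≤ x` for some `u' ∈ O`
  rw [chronologicalFuture_eq_biUnion] at hfut
  simp only [mem_iUnion, exists_prop] at hfut
  obtain ⟨_, ⟨u', hu'O, rfl⟩, hu't₁⟩ := hfut
  have ht₁x : x ∈ g.causalFuture τ {η t₁} := by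
    rcases eq_or_lt_of_le ht₁.2 with heq | hlt
    · rw [← hηb, ← heq]; exact subset_causalFuture g τ _ rfl
    · exact Or.inr ⟨η t₁, rfl, η, t₁, b, hlt, hη.mono (Icc_subset_Icc ht₁.1.le le_rfl), rfl, hηb⟩
  refine ⟨u', hu'O, ?_⟩
  exact mem_chronologicalPast_of_mem_chronologicalFuture
    (mem_chronologicalFuture_of_mem_chronologicalFuture_of_mem_causalFuture hn1 hu't₁ ht₁x)

/-- Time dual: a point of `ι(X)` causally ABOVE `x` is a limit of points of `ι(X)`
chronologically above `x`. [cite: ONeillSemiRiemannian1983, Ch. 14, Cor. 14.1 and Lemma 14.42] -/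
theorem mem_closure_preimage_chronologicalFuture (hn : 2 ≤ n)
    (hcwb : g.IsCausallyWellBehaved τ) {X' : Type*} [TopologicalSpace X'] {ι : X' → M}
    (hac : ∀ p ∈ range ι, ∀ q ∈ range ι, q ∈ g.causalFuture τ {p} → q = p)
    (hLT : ∀ (u : X') (O : Set X'), IsOpen O → u ∈ O → ∃ B : Set M, IsOpen B ∧ ι u ∈ B ∧
      B ⊆ ι '' O ∪ g.chronologicalFuture τ (ι '' O) ∪ g.chronologicalPast τ (ι '' O))
    {x : M} {u : X'} (hux : x ∈ g.causalPast τ {ι u}) (hne : x ≠ ι u) :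
    u ∈ closure (ι ⁻¹' g.chronologicalFuture τ {x}) := by
  have hac' : ∀ p ∈ range ι, ∀ q ∈ range ι, q ∈ g.causalFuture τ.reverse {p} → q = p :=
    fun p hp q hq h ↦ (hac q hq p hp (mem_causalPast_singleton_iff.1 h)).symm
  have hLT' : ∀ (u : X') (O : Set X'), IsOpen O → u ∈ O → ∃ B : Set M, IsOpen B ∧ ι u ∈ B ∧
      B ⊆ ι '' O ∪ g.chronologicalFuture τ.reverse (ι '' O) ∪
        g.chronologicalPast τ.reverse (ι '' O) := by
    intro u O hO huO
    obtain ⟨B, hB, huB, hBO⟩ := hLT u O hO huO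
    refine ⟨B, hB, huB, fun y hy ↦ ?_⟩
    rw [chronologicalPast_reverse]
    rcases hBO hy with (h | h) | h
    · exact Or.inl (Or.inl h)
    · exact Or.inr h
    · exact Or.inl (Or.inr h)
  have h := mem_closure_preimage_chronologicalPast (τ := τ.reverse) hn hcwb.reverse hac' hLT'
    hux hne
  rwa [chronologicalPast_reverse] at h

/-- **The causal shadow of `x` on `ι(X)` lies in the closure of its chronological shadow**: if
`ι⁻¹ I⁻(x) ⊆ K` with `K` closed and `x ∉ ι(X)`, then `ι⁻¹ J⁻(x) ⊆ K` (localised trichotomy,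
acausality, causality condition). [cite: ONeillSemiRiemannian1983, Ch. 14, Cor. 14.1 and Lemma 14.42] -/
theorem preimage_causalPast_subset_of_preimage_chronologicalPast_subset (hn : 2 ≤ n)
    (hcwb : g.IsCausallyWellBehaved τ) {X' : Type*} [TopologicalSpace X'] {ι : X' → M}
    (hac : ∀ p ∈ range ι, ∀ q ∈ range ι, q ∈ g.causalFuture τ {p} → q = p)
    (hLT : ∀ (u : X') (O : Set X'), IsOpen O → u ∈ O → ∃ B : Set M, IsOpen B ∧ ι u ∈ B ∧
      B ⊆ ι '' O ∪ g.chronologicalFuture τ (ι '' O) ∪ g.chronologicalPast τ (ι '' O))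
    {x : M} (hx : x ∉ range ι) {K : Set X'} (hK : IsClosed K)
    (hsh : ι ⁻¹' g.chronologicalPast τ {x} ⊆ K) : ι ⁻¹' g.causalPast τ {x} ⊆ K := by
  intro u hu
  have hux : x ∈ g.causalFuture τ {ι u} := mem_causalPast_singleton_iff.1 hu
  have hne : x ≠ ι u := fun h ↦ hx ⟨u, h.symm⟩
  exact closure_minimal hsh hK (mem_closure_preimage_chronologicalPast hn hcwb hac hLT hux hne)

/-- Time dual: `ι⁻¹ I⁺(x) ⊆ K` closed, `x ∉ ι(X)` ⟹ `ι⁻¹ J⁺(x) ⊆ K`.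
[cite: ONeillSemiRiemannian1983, Ch. 14, Cor. 14.1 and Lemma 14.42] -/
theorem preimage_causalFuture_subset_of_preimage_chronologicalFuture_subset (hn : 2 ≤ n)
    (hcwb : g.IsCausallyWellBehaved τ) {X' : Type*} [TopologicalSpace X'] {ι : X' → M}
    (hac : ∀ p ∈ range ι, ∀ q ∈ range ι, q ∈ g.causalFuture τ {p} → q = p)
    (hLT : ∀ (u : X') (O : Set X'), IsOpen O → u ∈ O → ∃ B : Set M, IsOpen B ∧ ι u ∈ B ∧
      B ⊆ ι '' O ∪ g.chronologicalFuture τ (ι '' O) ∪ g.chronologicalPast τ (ι '' O))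
    {x : M} (hx : x ∉ range ι) {K : Set X'} (hK : IsClosed K)
    (hsh : ι ⁻¹' g.chronologicalFuture τ {x} ⊆ K) : ι ⁻¹' g.causalFuture τ {x} ⊆ K := by
  intro u hu
  have hux : x ∈ g.causalPast τ {ι u} := mem_causalPast_singleton_iff.2 hu
  have hne : x ≠ ι u := fun h ↦ hx ⟨u, h.symm⟩
  exact closure_minimal hsh hK (mem_closure_preimage_chronologicalFuture hn hcwb hac hLT hux hne)

end LorentzianMetric

end Literature.Geometry.Lorentzian

end
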